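import Literature.MathematicalPhysics.QuantumFieldTheory.Balaban1983to89.Node00.OpsYOps312OfRecordPar
import Literature.MathematicalPhysics.QuantumFieldTheory.Balaban1983to89.Node00.OpsYRecordV11Thresh

/-!
# `Balaban1983to89.Node00.OpsYSectDCoordsQ` — T. Bałaban, *Propagators for lattice gauge theories in a background field*, Commun. Math. Phys. **99** (1985)
# 389–434 [Balaban1985BackgroundPropagators], Sect. D, (3.122)–(3.132) pp. 420–422 and (3.153) p. 426: THE SECT.-D COORDINATE ALGEBRA OF `OpsYSectDCoords`
# §6∕§7 RE-PRESSED ONCE OVER A GENERIC AVERAGING PAIR `(𝔮, 𝔮⋆)`, A SITE TRANSPORTER `parS`, A SITE PROPAGATOR `G′` AND A RESIDUAL `Δ⁽²⁾` — the seven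
# definitional identities `invG0′ ∕ invG ∕ invG1 ∕ eq126 ∕ eq129 ∕ c1_inv ∕ eq153` on the `𝔮`-generic models, and the transposes `adjQ ∕ symmR` (generic, and
# ★★ at PRINT's knit pair ∕ knit transporter of record)

statement-level skeleton of published theorems with citation tags; proofs where landed; nothing here is a claim about the Yang–Mills mass gap

THE POINT (dag-n06-d g25's K3-D SUPPLIER CENSUS, «WANTED (by owner) — def-Y: q-generic `identitiesDef_of_pins_phys` (Sect.-D coordinate algebra at
(𝔮, 𝔮s, parS))»; g24 INTENT-9: «§2 (the ten definitional Sect.-D identities) needs def-Y's `𝔮`-generic coordinate algebra (`GcoK_GAQY_mul_S0coKq`,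
`QcoKHq_G1_Qs_C1_eq_id`, …) — K0 owner's»).  dag-n06-d's `identitiesDef_of_pins_phys` (`…N06SectDUnitsAtPinsPhys` §2) derives the knit's ten definitional
Sect.-D identities `IdentitiesDef 𝔬 U` from def-Y's coordinate algebra `OpsYSectDCoords` §6 (`GcoK_GAY_mul_S0coK ∕ S0coK_sub_TpicoK_mul_GcoK_GDY ∕
S0coK_sub_mul_GcoK_G1Y ∕ HcoK_HDY_eq ∕ HcoK_H1Y_eq ∕ QcoKH_G1_Qs_C1_eq_id ∕ GcoK_GGY_eq_frakPstar`) and §7 (`isTransposePair_QcoKH_QscoKH ∕ _DvcoKH_DvscoKH ∕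
_RcoK`) — all PINNED to the straight averaging pair `(QY parB, QsY parB)`.  The knit certificate «KD» reads the same ten fields at the `𝔮`-GENERIC Sect.-D
letters of `OpsYSectDQ` (`deltaAQY ∕ GAQY ∕ deltaPiAQY ∕ GDQY ∕ deltaOneQY ∕ G1QY ∕ HDQY ∕ H1QY ∕ QG1QinvQY ∕ GGQY i 𝔮 𝔮⋆ parS G′ [Δ⁽²⁾]`) on the `𝔮`-generic
models of `OpsYOps312OfRecordPar` §0 (`S0coKq ∕ QcoKHq ∕ QscoKHq ∕ CcoKq ∕ C1coKq`; the pair-independent `TpicoK ∕ T2coK ∕ RcoK ∕ DvcoKH ∕ DvscoKH ∕ GcoK ∕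
HcoK` unchanged), at print's pair `(qKnitOfRecord, qsKnitOfRecord)` and transporter `parKnitY`.  THIS FILE is that ONE parametric re-press — every proof is
the landed §6∕§7 proof with the letter identity swapped for its `OpsYSectDQ` §2 twin (`GAY_mul_deltaAY ↦ GAQY_mul_deltaAQY`, `deltaPiAY_eq_deltaAY_sub ↦
deltaPiAQY_eq_deltaAQY_sub`, `deltaPiAY_mul_GDY ↦ deltaPiAQY_mul_GDQY`, `deltaOneY_eq_deltaAY_sub ↦ deltaOneQY_eq_deltaAQY_sub`, `deltaOneY_mul_G1Y ↦
deltaOneQY_mul_G1QY`, `QY_comp_H1Y ↦ comp_H1QY`, `GGY_eq_3153 ↦ GGQY_eq_3153`):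
* §1 over ANY complete finite-dimensional fibre `𝔸`, any real basis `b` with `c_R(b) ≠ 0`, any class `B`, reading `cfg`: ★ `GcoK_GAQY_mul_S0coKq` (`invG0′`:
  `G·Δ_a[𝔮] = 1` — ALSO dag-n06-l's WANTED `hinv12` twin of `GcoK_GAY_mul_S0coK`), ★ `S0coKq_sub_TpicoK_mul_GcoK_GDQY` (`invG`, (3.122)), ★
  `S0coKq_sub_mul_GcoK_G1QY` (`invG1`, (3.128)∕(3.138)), ★ `HcoK_HDQY_eq` (`eq126`), ★ `HcoK_H1QY_eq` (`eq129`), ★ `QcoKHq_G1_Qs_C1_eq_id` (`c1_inv`, (3.127) for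
  `G₁`), ★★ `GcoK_GGQY_eq_frakPstar` (`eq153`, (3.147)∕(3.153) spelled as the knit's `frakPstar`); plus the seven `rfl` FACES at the straight pair
  (`…_QY`: each twin IS the `OpsYSectDCoords` original at `(QY parB, QsY parB)`);
* §2 over the trace basis of `M_N(ℂ)` (no basis hypothesis): ★ `isTransposePair_QcoKHq_QscoKHq` (`adjQ` for ANY pair adjoint in `trIP`, `IsAdjTr 1 1 (𝔮 U)
  (𝔮⋆ U)`), ★★ `isTransposePair_QcoKHq_QscoKHq_knit` (print's knit pair of record — at EVERY configuration, `isAdjTr_qKnitOfRecord`: `𝔮⋆ := 𝔮†`),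
  ★ `isTransposePair_RcoK_of_isSymmTr` (`symmR` from `IsSymmTr 1 (R(U))`, any `parS ∕ G′`), ★★ `isTransposePair_RcoK_parKnitY` (`R` over `parKnitY` fed
  `G′_phys` at a `G`-valued background with `G`-valued knit legs — def-Y `RY_GpPhysY_parKnitY_isSymmTr`, dag-n06-l `RY_parKnitY_isSymmTr`), ★★
  `isTransposePair_RcoK_parKnitY_of_regQY` (the same ON PRINT's CLASS (3.35), legs discharged by `parKnitY_mem_unitary_of_regQY`; numerics `c₀ ≤ 10`,
  `0 ≤ Mα₀`, `0 < α₀′`, `C₀α₀′ ≤ 1/3`, `2α₀′ ≤ c₂′`, `K_pl(Mα₀)·L⁴ < α₀′`), `_SU_threshK` (member-law shape over `bg9YP … SU(N)`); `adjDv` is pair-free —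
  `OpsYSectDCoords.isTransposePair_DvcoKH_DvscoKH` by name.
CONSUMER RECIPE (dag-n06-d «KD» `identitiesDef_of_pins_physQ`): the ten `refine { invG0' … symmR }` bullets of `identitiesDef_of_pins_phys` with `S0coK ↦ S0coKq i b B cfg 𝔮 𝔮s
parS G′`, `QcoKH ↦ QcoKHq i b B cfg 𝔮`, `QscoKH ↦ QscoKHq i b B cfg 𝔮s`, `CcoK ↦ CcoKq …`, `C1coK ↦ C1coKq … Δ2`, `GAY ↦ GAQY`, `GDY ↦ GDQY`, `G1Y ↦ G1QY`,
`GGY ↦ GGQY`, `HDY ↦ HDQY`, `H1Y ↦ H1QY`, `QGQOfY parB ↦ QGQOfQY 𝔮 𝔮s` and the lemmas of this file in place of their §6∕§7 namesakes; `adjQ` at the knit pair needs NO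
class hypothesis (`_knit`), `symmR` at `parKnitY ∕ GpPhysY parKnitY` is regime-keyed (`_of_regQY`), exactly like `hparK`.
HONEST SCOPE.  Finite-dimensional linear algebra over landed letters, proofs copied with the letter swapped; no new object; nothing of [B9] or [5] asserted;
the units `IsUnit (Δ_a[𝔮] ∕ G̃⁻¹[𝔮] ∕ G₁⁻¹[𝔮] ∕ 𝔮G₁𝔮⋆)` stay HYPOTHESES (dag-n06-d `…SectDUnitsAtPinsPhysQ` supplies them from rows 20–21); COUNT-NEUTRAL
(`--supports stmt-QuantumFields-20541`); N06 NOT discharged; K1⁹ NOT closed.  One finite lattice at a time — nothing continuum ∕ ℝ⁴ ∕ OS ∕ mass gap ∕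
Clay.  Cell `pub-ymgap` (HUMAN RULING D-0062), Track A NODE 00, seat `pub-ymgap-node00-def-Y` (g33), 2026-08-30.
-/

noncomputable section

namespace Literature.MathematicalPhysics.QuantumFieldTheory.Balaban1983to89.Node00.OpsYSectDCoordsQ

open B6KLevelCensusIndexV1 (KIdx kGeo)
open B9PinMembersKLevelV1 (MemberY geo9Y)
open B9Thm37Glue (IsTransposePair)
open B9Thm311ReadingCoords (IsAdjTr IsSymmTr)
open B9CoReadingCoords (XBK GcoK coordOpK coordOpK_comp)
open B9CoReadingCoordsH (XHK HcoK coordOpKH coordOpK_comp_coordOpKH)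
open B9CoReadingCoordsS (XSK)
open B9CoReadingCoordsTranspose (TrIdx trBasis trBasis_repr_eq_trace isTransposePair_coordOpK_of_isSymmTr)
open B9Eq3132SectDLetters (deltaPiAY GDY QGQinvY HDY)
open B9Thm39ReadingCoords (cR39)
open B7Prop2SpecialUnitary (specialUnitaryUnits specialUnitaryUnits_le_unitaryUnits)
open B7Prop2Explicit (C0 c2')
open B9C2FormBoxRegimeY (Kpl)
open B9B8AveragingJunction (parKnitY)
open B9BackgroundsKLevelV1P (bg9KP bg9YP)
open OpsYSectDCoords (S0coK TpicoK T2coK QcoKH QscoKH CcoK C1coK DvcoKH DvscoKH RcoK coordOpK_id coordOpK_const_one coordOpKH_eq_coordOpK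
  isTransposePair_coordOpKH_trBasis coordOpK_const_sub coordOpK_const_add coordOpK_const_comp coordOpKH_const_comp_coordOpK_const coordOpK_const_comp_coordOpKH_const
  coordOpKH_const_comp_coordOpKH_const)
open OpsYOps312OfRecordPar (S0coKq QcoKHq QscoKHq CcoKq C1coKq)
open OpsYQLetter (QLetterY QsLetterY regQY mem_of_regQY parKnitY_mem_unitary_of_regQY qKnitOfRecord qsKnitOfRecord)
open scoped Matrix Matrix.Norms.L2Operator

/-! ## §0 Helpers (the `OpsYSectDCoords` §4b private kit, restated privately) -/

section Helpers

variable {𝔸 : Type} [NormedRing 𝔸] [NormedAlgebra ℂ 𝔸]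

/-- scalars of a composite of scaled maps. [folklore] -/
private theorem smul_comp_smul {X₁ X₂ X₃ : Type} (r s : ℝ) (A : (X₂ → ℝ) →ₗ[ℝ] (X₃ → ℝ)) (C : (X₁ → ℝ) →ₗ[ℝ] (X₂ → ℝ)) :
    (r • A) ∘ₗ (s • C) = (r * s) • (A ∘ₗ C) := by
  rw [LinearMap.smul_comp, LinearMap.comp_smul, smul_smul]

/-- `restrictScalars` of a product (definitional). [folklore] -/
private theorem restrictScalars_mul' {T : Type} (f g : Module.End ℂ (T → 𝔸)) : (f * g).restrictScalars ℝ = f.restrictScalars ℝ * g.restrictScalars ℝ := rfl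

/-- `restrictScalars` of `1` is `1` (definitional). [folklore] -/
private theorem restrictScalars_one' {T : Type} : (1 : Module.End ℂ (T → 𝔸)).restrictScalars ℝ = 1 := rfl

/-- `restrictScalars` of a difference (definitional). [folklore] -/
private theorem restrictScalars_sub' {T T' : Type} (f g : (T → 𝔸) →ₗ[ℂ] (T' → 𝔸)) : (f - g).restrictScalars ℝ = f.restrictScalars ℝ - g.restrictScalars ℝ := rfl

/-- `restrictScalars` of a sum (definitional). [folklore] -/
private theorem restrictScalars_add' {T T' : Type} (f g : (T → 𝔸) →ₗ[ℂ] (T' → 𝔸)) : (f + g).restrictScalars ℝ = f.restrictScalars ℝ + g.restrictScalars ℝ := rfl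

/-- a transpose pair scaled on both sides by the same real is a transpose pair. [folklore] -/
private theorem isTransposePair_smul_smul {X Y : Type} [Fintype X] [Fintype Y] {A : (X → ℝ) →ₗ[ℝ] (Y → ℝ)} {B : (Y → ℝ) →ₗ[ℝ] (X → ℝ)}
    (h : IsTransposePair A B) (r : ℝ) : IsTransposePair (r • A) (r • B) := by
  intro u v
  simp only [LinearMap.smul_apply, Pi.smul_apply, smul_eq_mul]
  calc ∑ y, r * A u y * v y = r * ∑ y, A u y * v y := by rw [Finset.mul_sum]; exact Finset.sum_congr rfl fun y _ => by ring
    _ = r * ∑ x, u x * B v x := by rw [h u v]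
    _ = ∑ x, u x * (r * B v x) := by rw [Finset.mul_sum]; exact Finset.sum_congr rfl fun x _ => by ring

end Helpers

/-! ## §1 The seven definitional identities `invG0′ ∕ invG ∕ invG1 ∕ eq126 ∕ eq129 ∕ c1_inv ∕ eq153` on the `𝔮`-generic models -/

section IdentitiesQ

variable {𝔸 : Type} [NormedRing 𝔸] [NormedAlgebra ℂ 𝔸] [CompleteSpace 𝔸] [FiniteDimensional ℝ 𝔸] {κ : Type} [Fintype κ]
variable {d ℓ : ℕ} {hd : 1 ≤ d + 1} {hL : Odd (ℓ + 1) ∧ 1 < ℓ + 1} {b₀ b₁ : ℝ} (i : KIdx d ℓ hd hL b₀ b₁)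
  (b : Module.Basis κ ℝ 𝔸) (B : B9.Backgrounds) (cfg : B.Cfg → CfgY 𝔸 i)
  (𝔮 : QLetterY 𝔸 i) (𝔮s : QsLetterY 𝔸 i) (parS : SiteParY 𝔸 i) (parB : BondParY 𝔸 i) (Gp : SiteOpY 𝔸 i) (Δ2 : BondOpY 𝔸 i)

variable {i b B cfg 𝔮 𝔮s parS Gp Δ2}

/-- ★ **`invG0′` on the `𝔮`-generic models: `G[𝔮]·Δ_a[𝔮] = 1`** (`GcoK` of `G_A[𝔮] = Δ_a[𝔮]⁻¹` times `S0coKq`), wherever `Δ_a[𝔮](U)` is a unit — ALSO the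
`GAQY` twin of `GcoK_GAY_mul_S0coK` that the knit certificate's `hinv12` wants. [cite: Balaban1985BackgroundPropagators, (3.27) p.395, p.421 («G₀»), (3.115) p.418] -/
theorem GcoK_GAQY_mul_S0coKq (hc : cR39 b ≠ 0) {U₁ : B.Cfg} (hU : IsUnit (deltaAQY i 𝔮 𝔮s parS Gp (cfg U₁))) :
    GcoK i b B cfg (GAQY i 𝔮 𝔮s parS Gp) U₁ * S0coKq i b B cfg 𝔮 𝔮s parS Gp U₁ = 1 := by
  rw [GcoK, S0coKq, Module.End.mul_eq_comp, smul_comp_smul, mul_inv_cancel₀ hc, one_smul, ← coordOpK_const_comp,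
    ← Module.End.mul_eq_comp, ← restrictScalars_mul']
  rw [show GAQY i 𝔮 𝔮s parS Gp (cfg U₁) * deltaAQY i 𝔮 𝔮s parS Gp (cfg U₁) = 1 from GAQY_mul_deltaAQY hU, restrictScalars_one']
  exact coordOpK_const_one b

/-- ★ **`invG` on the `𝔮`-generic models: `(Δ_a[𝔮] − Δ′_π)·G̃[𝔮] = 1`** ((3.122) = (3.26) − (3.121)), wherever `G̃⁻¹[𝔮](U)` is a unit.
[cite: Balaban1985BackgroundPropagators, (3.122) p.420, (3.130) p.421, (3.115) p.418] -/
theorem S0coKq_sub_TpicoK_mul_GcoK_GDQY (hc : cR39 b ≠ 0) {U₁ : B.Cfg} (hU : IsUnit (deltaPiAQY i 𝔮 𝔮s parS Gp (cfg U₁))) :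
    (S0coKq i b B cfg 𝔮 𝔮s parS Gp U₁ - TpicoK i b B cfg parS Gp U₁) * GcoK i b B cfg (GDQY i 𝔮 𝔮s parS Gp) U₁ = 1 := by
  rw [S0coKq, TpicoK, GcoK, Module.End.mul_eq_comp, LinearMap.sub_comp, smul_comp_smul, smul_comp_smul, inv_mul_cancel₀ hc, one_smul, one_smul,
    ← coordOpK_const_comp, ← coordOpK_const_comp, ← coordOpK_const_sub, ← LinearMap.sub_comp, ← restrictScalars_sub', ← deltaPiAQY_eq_deltaAQY_sub,
    ← Module.End.mul_eq_comp, ← restrictScalars_mul']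
  rw [show deltaPiAQY i 𝔮 𝔮s parS Gp (cfg U₁) * GDQY i 𝔮 𝔮s parS Gp (cfg U₁) = 1 from deltaPiAQY_mul_GDQY hU, restrictScalars_one']
  exact coordOpK_const_one b

/-- ★ **`invG1` on the `𝔮`-generic models: `(Δ_a[𝔮] − (Δ′_π + Δ⁽²⁾_π))·G₁[𝔮] = 1`** ((3.128) via (3.138)), wherever `G₁⁻¹[𝔮](U)` is a unit.
[cite: Balaban1985BackgroundPropagators, (3.128) p.421, (3.138) p.423, (3.115) p.418] -/
theorem S0coKq_sub_mul_GcoK_G1QY (hc : cR39 b ≠ 0) {U₁ : B.Cfg} (hU : IsUnit (deltaOneQY i 𝔮 𝔮s parS Gp Δ2 (cfg U₁))) :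
    (S0coKq i b B cfg 𝔮 𝔮s parS Gp U₁ - (TpicoK i b B cfg parS Gp U₁ + T2coK i b B cfg parS Gp Δ2 U₁)) *
      GcoK i b B cfg (G1QY i 𝔮 𝔮s parS Gp Δ2) U₁ = 1 := by
  rw [S0coKq, TpicoK, T2coK, GcoK, Module.End.mul_eq_comp, LinearMap.sub_comp, LinearMap.add_comp, smul_comp_smul, smul_comp_smul, smul_comp_smul,
    inv_mul_cancel₀ hc, one_smul, one_smul, one_smul, ← coordOpK_const_comp, ← coordOpK_const_comp, ← coordOpK_const_comp, ← coordOpK_const_add,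
    ← coordOpK_const_sub, ← LinearMap.add_comp, ← LinearMap.sub_comp, ← restrictScalars_add', ← restrictScalars_sub', ← deltaOneQY_eq_deltaAQY_sub,
    ← Module.End.mul_eq_comp, ← restrictScalars_mul', deltaOneQY_mul_G1QY hU, restrictScalars_one']
  exact coordOpK_const_one b

/-- ★ **`eq126` on the `𝔮`-generic models: `H[𝔮] = G̃[𝔮] ∘ 𝔮⋆ ∘ C[𝔮]`** (3.126) — definitional for def-Y's `HDQY`, the scalings `c·c⁻¹·c = c` matching `HcoK`'s.
[cite: Balaban1985BackgroundPropagators, (3.126) p.420, (3.115) p.418] -/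
theorem HcoK_HDQY_eq (hc : cR39 b ≠ 0) (U₁ : B.Cfg) :
    HcoK i b B cfg (HDQY i 𝔮 𝔮s parS Gp) U₁ =
      GcoK i b B cfg (GDQY i 𝔮 𝔮s parS Gp) U₁ ∘ₗ QscoKHq i b B cfg 𝔮s U₁ ∘ₗ CcoKq i b B cfg 𝔮 𝔮s parS Gp U₁ := by
  rw [HcoK, GcoK, QscoKHq, CcoKq, smul_comp_smul, smul_comp_smul, inv_mul_cancel₀ hc, mul_one, coordOpKH_const_comp_coordOpK_const,
    coordOpK_const_comp_coordOpKH_const]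
  rfl

/-- ★ **`eq129` on the `𝔮`-generic models: `H₁[𝔮] = G₁[𝔮] ∘ 𝔮⋆ ∘ C₁[𝔮]`** (3.129). [cite: Balaban1985BackgroundPropagators, (3.129) p.421, (3.115) p.418] -/
theorem HcoK_H1QY_eq (hc : cR39 b ≠ 0) (U₁ : B.Cfg) :
    HcoK i b B cfg (H1QY i 𝔮 𝔮s parS Gp Δ2) U₁ =
      GcoK i b B cfg (G1QY i 𝔮 𝔮s parS Gp Δ2) U₁ ∘ₗ QscoKHq i b B cfg 𝔮s U₁ ∘ₗ C1coKq i b B cfg 𝔮 𝔮s parS Gp Δ2 U₁ := by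
  rw [HcoK, GcoK, QscoKHq, C1coKq, smul_comp_smul, smul_comp_smul, inv_mul_cancel₀ hc, mul_one, coordOpKH_const_comp_coordOpK_const,
    coordOpK_const_comp_coordOpKH_const]
  rfl

/-- ★ **`c1_inv` on the `𝔮`-generic models: `𝔮 ∘ G₁[𝔮] ∘ 𝔮⋆ ∘ C₁[𝔮] = id`** ((3.127) for `G₁`: `𝔮H₁ = I`, def-Y `comp_H1QY`), wherever `(𝔮G₁𝔮⋆)(U)` is a unit.
[cite: Balaban1985BackgroundPropagators, (3.127) p.421, (3.132) p.422, (3.115) p.418] -/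
theorem QcoKHq_G1_Qs_C1_eq_id (hc : cR39 b ≠ 0) {U₁ : B.Cfg} (hU : IsUnit (QGQOfQY i 𝔮 𝔮s (G1QY i 𝔮 𝔮s parS Gp Δ2) (cfg U₁))) :
    QcoKHq i b B cfg 𝔮 U₁ ∘ₗ GcoK i b B cfg (G1QY i 𝔮 𝔮s parS Gp Δ2) U₁ ∘ₗ QscoKHq i b B cfg 𝔮s U₁ ∘ₗ C1coKq i b B cfg 𝔮 𝔮s parS Gp Δ2 U₁ =
      LinearMap.id := by
  rw [QcoKHq, GcoK, QscoKHq, C1coKq, smul_comp_smul, smul_comp_smul, smul_comp_smul, inv_mul_cancel₀ hc, mul_one, inv_mul_cancel₀ hc, one_smul,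
    coordOpKH_const_comp_coordOpK_const, coordOpK_const_comp_coordOpKH_const, coordOpKH_const_comp_coordOpKH_const]
  have h : (𝔮 (cfg U₁)).restrictScalars ℝ ∘ₗ ((G1QY i 𝔮 𝔮s parS Gp Δ2 (cfg U₁)).restrictScalars ℝ ∘ₗ
      ((𝔮s (cfg U₁)).restrictScalars ℝ ∘ₗ (QG1QinvQY i 𝔮 𝔮s parS Gp Δ2 (cfg U₁)).restrictScalars ℝ)) =
      (LinearMap.id : (IBondY i → 𝔸) →ₗ[ℝ] (IBondY i → 𝔸)) := by
    show (𝔮 (cfg U₁) ∘ₗ H1QY i 𝔮 𝔮s parS Gp Δ2 (cfg U₁)).restrictScalars ℝ = _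
    rw [comp_H1QY hU]; rfl
  rw [h, coordOpKH_eq_coordOpK]
  exact coordOpK_id b

/-- ★★ **`eq153` on the `𝔮`-generic models: `𝔊[𝔮] = G₁[𝔮] ∘ 𝔓*[𝔮]`** with `𝔓* = I − 𝔮⋆C₁𝔮G₁ − DRD*G₁` spelled exactly as the knit's `frakPstar` (3.147)∕(3.153) —
from def-Y's `GGQY_eq_3153`; all scalings cancel. [cite: Balaban1985BackgroundPropagators, (3.147) p.425, (3.153) p.426, (3.115) p.418] -/
theorem GcoK_GGQY_eq_frakPstar (hc : cR39 b ≠ 0) (U₁ : B.Cfg) :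
    GcoK i b B cfg (GGQY i 𝔮 𝔮s parS Gp Δ2) U₁ =
      GcoK i b B cfg (G1QY i 𝔮 𝔮s parS Gp Δ2) U₁ ∘ₗ
        (LinearMap.id - QscoKHq i b B cfg 𝔮s U₁ ∘ₗ C1coKq i b B cfg 𝔮 𝔮s parS Gp Δ2 U₁ ∘ₗ QcoKHq i b B cfg 𝔮 U₁ ∘ₗ
            GcoK i b B cfg (G1QY i 𝔮 𝔮s parS Gp Δ2) U₁
          - DvcoKH i b B cfg U₁ ∘ₗ RcoK i b B cfg parS Gp U₁ ∘ₗ DvscoKH i b B cfg U₁ ∘ₗ GcoK i b B cfg (G1QY i 𝔮 𝔮s parS Gp Δ2) U₁) := by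
  have hX : QscoKHq i b B cfg 𝔮s U₁ ∘ₗ C1coKq i b B cfg 𝔮 𝔮s parS Gp Δ2 U₁ ∘ₗ QcoKHq i b B cfg 𝔮 U₁ ∘ₗ GcoK i b B cfg (G1QY i 𝔮 𝔮s parS Gp Δ2) U₁ =
      coordOpK b (fun _ : Fin (d + 1) => (𝔮s (cfg U₁) ∘ₗ QG1QinvQY i 𝔮 𝔮s parS Gp Δ2 (cfg U₁) ∘ₗ 𝔮 (cfg U₁) ∘ₗ
        G1QY i 𝔮 𝔮s parS Gp Δ2 (cfg U₁)).restrictScalars ℝ) := by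
    rw [QscoKHq, C1coKq, QcoKHq, GcoK, smul_comp_smul, smul_comp_smul, smul_comp_smul, inv_mul_cancel₀ hc, mul_one, inv_mul_cancel₀ hc, one_smul,
      coordOpKH_const_comp_coordOpK_const, coordOpK_const_comp_coordOpKH_const, coordOpKH_const_comp_coordOpKH_const, coordOpKH_eq_coordOpK]
    rfl
  have hY : DvcoKH i b B cfg U₁ ∘ₗ RcoK i b B cfg parS Gp U₁ ∘ₗ DvscoKH i b B cfg U₁ ∘ₗ GcoK i b B cfg (G1QY i 𝔮 𝔮s parS Gp Δ2) U₁ =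
      coordOpK b (fun _ : Fin (d + 1) => (gradY i (cfg U₁) ∘ₗ RY i parS Gp (cfg U₁) ∘ₗ divY i (cfg U₁) ∘ₗ
        G1QY i 𝔮 𝔮s parS Gp Δ2 (cfg U₁)).restrictScalars ℝ) := by
    rw [DvcoKH, RcoK, DvscoKH, GcoK, LinearMap.comp_smul, LinearMap.comp_smul, LinearMap.comp_smul, LinearMap.smul_comp, LinearMap.comp_smul, smul_smul,
      mul_inv_cancel₀ hc, one_smul, coordOpKH_const_comp_coordOpK_const, coordOpK_const_comp_coordOpKH_const, coordOpKH_const_comp_coordOpKH_const,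
      coordOpKH_eq_coordOpK]
    rfl
  rw [hX, hY, GcoK, GcoK, LinearMap.smul_comp]
  congr 1
  rw [← coordOpK_id b, ← coordOpK_const_sub, ← coordOpK_const_sub, ← coordOpK_const_comp]
  congr 1
  funext ν
  rw [GGQY_eq_3153, LinearMap.comp_sub, LinearMap.comp_sub, LinearMap.comp_id]
  exact LinearMap.ext fun _ => rfl

/-! ### The straight-pair faces: each twin IS its `OpsYSectDCoords` §6 original at `(QY parB, QsY parB)` (definitionally) -/

/-- FACE (`rfl`): `invG0′` twin at the straight pair. [cite: Balaban1985BackgroundPropagators, (3.27) p.395, (3.12)–(3.13) p.392, bookkeeping] -/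
theorem GcoK_GAQY_mul_S0coKq_QY (U₁ : B.Cfg) :
    GcoK i b B cfg (GAQY i (QY i parB) (QsY i parB) parS Gp) U₁ * S0coKq i b B cfg (QY i parB) (QsY i parB) parS Gp U₁ =
      GcoK i b B cfg (GAY i parS parB Gp) U₁ * S0coK i b B cfg parS parB Gp U₁ := rfl

/-- FACE (`rfl`): `eq126` twin's right-hand side at the straight pair. [cite: Balaban1985BackgroundPropagators, (3.126) p.420, (3.12)–(3.13) p.392, bookkeeping] -/
theorem GcoK_GDQY_QscoKHq_CcoKq_QY (U₁ : B.Cfg) :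
    GcoK i b B cfg (GDQY i (QY i parB) (QsY i parB) parS Gp) U₁ ∘ₗ QscoKHq i b B cfg (QsY i parB) U₁ ∘ₗ CcoKq i b B cfg (QY i parB) (QsY i parB) parS Gp U₁ =
      GcoK i b B cfg (GDY i parS parB Gp) U₁ ∘ₗ QscoKH i b B cfg parB U₁ ∘ₗ CcoK i b B cfg parS parB Gp U₁ := rfl

/-- FACE (`rfl`): `eq129` twin's right-hand side at the straight pair. [cite: Balaban1985BackgroundPropagators, (3.129) p.421, (3.12)–(3.13) p.392, bookkeeping] -/
theorem GcoK_G1QY_QscoKHq_C1coKq_QY (U₁ : B.Cfg) :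
    GcoK i b B cfg (G1QY i (QY i parB) (QsY i parB) parS Gp Δ2) U₁ ∘ₗ QscoKHq i b B cfg (QsY i parB) U₁ ∘ₗ
        C1coKq i b B cfg (QY i parB) (QsY i parB) parS Gp Δ2 U₁ =
      GcoK i b B cfg (G1Y i parS parB Gp Δ2) U₁ ∘ₗ QscoKH i b B cfg parB U₁ ∘ₗ C1coK i b B cfg parS parB Gp Δ2 U₁ := rfl

end IdentitiesQ

/-! ## §2 `adjQ ∕ symmR` over the trace basis of `M_N(ℂ)`: generic pair ∕ transporter, and ★★ at PRINT's knit pair ∕ knit transporter of record -/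

section TransposesQ

variable {N : ℕ} {d ℓ : ℕ} {hd : 1 ≤ d + 1} {hL : Odd (ℓ + 1) ∧ 1 < ℓ + 1} {b₀ b₁ : ℝ} (i : KIdx d ℓ hd hL b₀ b₁)
  (B : B9.Backgrounds) (cfg : B.Cfg → CfgY (Matrix (Fin N) (Fin N) ℂ) i) (U₁ : B.Cfg)

/-- ★ **`adjQ` for a GENERIC pair**: the models of `𝔮(U)` and `𝔮⋆(U)` (common scaling `c⁻¹`) are a transpose pair whenever the pair is adjoint in the trace
pairing, `IsAdjTr 1 1 (𝔮 U) (𝔮⋆ U)`. [cite: Balaban1985BackgroundPropagators, (3.13) p.392 (Q* the adjoint of Q), (3.115) p.418] -/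
theorem isTransposePair_QcoKHq_QscoKHq (𝔮 : QLetterY (Matrix (Fin N) (Fin N) ℂ) i) (𝔮s : QsLetterY (Matrix (Fin N) (Fin N) ℂ) i)
    (hQ : IsAdjTr (fun _ => (1 : ℝ)) (fun _ => (1 : ℝ)) (𝔮 (cfg U₁)) (𝔮s (cfg U₁))) :
    IsTransposePair (QcoKHq i (trBasis N) B cfg 𝔮 U₁) (QscoKHq i (trBasis N) B cfg 𝔮s U₁) :=
  isTransposePair_smul_smul (isTransposePair_coordOpKH_trBasis _ _ fun _ => hQ) _

/-- ★★ **`adjQ` AT PRINT's KNIT PAIR OF RECORD, AT EVERY CONFIGURATION**: `qsKnitOfRecord` IS the trace adjoint of `qKnitOfRecord` (def-Y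
`isAdjTr_qKnitOfRecord`), so the knit models are a transpose pair with NO class hypothesis. [cite: Balaban1985BackgroundPropagators, (3.13) p.392, (3.115) p.418]
[cite: Balaban1985Averaging, (15) p.19] -/
theorem isTransposePair_QcoKHq_QscoKHq_knit [Nonempty (Fin N)] {θ : Stage3Params} (i : KIdx θ.d₆ θ.ℓ₆ θ.hd' θ.hL' θ.b₀ θ.b₁) (B : B9.Backgrounds)
    (cfg : B.Cfg → CfgY (Matrix (Fin N) (Fin N) ℂ) i) (U₁ : B.Cfg) :
    IsTransposePair (QcoKHq i (trBasis N) B cfg (qKnitOfRecord N θ i) U₁) (QscoKHq i (trBasis N) B cfg (qsKnitOfRecord N θ i) U₁) :=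
  isTransposePair_QcoKHq_QscoKHq i B cfg U₁ _ _ (isAdjTr_qKnitOfRecord i (cfg U₁))

/-- ★ **`symmR` for a GENERIC transporter ∕ site propagator**: the model of `R(U)` is its own transpose whenever `R(U)` is symmetric in the trace pairing.
[cite: Balaban1985BackgroundPropagators, (3.25) p.394, Thm 3.11 p.416 («symmetric»)] -/
theorem isTransposePair_RcoK_of_isSymmTr (parS : SiteParY (Matrix (Fin N) (Fin N) ℂ) i) (Gp : SiteOpY (Matrix (Fin N) (Fin N) ℂ) i)
    (hR : IsSymmTr (fun _ => (1 : ℝ)) (RY i parS Gp (cfg U₁))) :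
    IsTransposePair (RcoK i (trBasis N) B cfg parS Gp U₁) (RcoK i (trBasis N) B cfg parS Gp U₁) :=
  isTransposePair_smul_smul (isTransposePair_coordOpK_of_isSymmTr (trBasis N) (trBasis_repr_eq_trace N) _ hR) _

/-- ★★ **`symmR` OVER PRINT's KNIT TRANSPORTER FED `G′_phys`** at a `G`-valued configuration with `G`-valued knit legs, `G ≤ U(N)` (def-Y
`RY_GpPhysY_parKnitY_isSymmTr` ∕ dag-n06-l `RY_parKnitY_isSymmTr`). [cite: Balaban1985BackgroundPropagators, (3.25) p.394, Thm 3.11 p.416] [cite: Balaban1985Averaging, Prop. 2 p.26] -/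
theorem isTransposePair_RcoK_parKnitY {G : Subgroup (Matrix (Fin N) (Fin N) ℂ)ˣ} (hG : G ≤ B7Prop2Explicit.unitaryUnits (Matrix (Fin N) (Fin N) ℂ))
    (hU : ∀ μ x, cfg U₁ μ x ∈ G) (hpar : ∀ z w : SiteY i, parKnitY i (cfg U₁) z w ∈ G) :
    IsTransposePair (RcoK i (trBasis N) B cfg (parKnitY i) (GpPhysY i (parKnitY i)) U₁) (RcoK i (trBasis N) B cfg (parKnitY i) (GpPhysY i (parKnitY i)) U₁) :=
  isTransposePair_RcoK_of_isSymmTr i B cfg U₁ _ _ (RY_GpPhysY_parKnitY_isSymmTr i hG hU hpar)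

/-- ★★ **`symmR` OVER THE KNIT TRANSPORTER ON PRINT's CLASS (3.35)**: at a configuration of `regQY G i c₀ α₀`, `G ≤ U(N)`, the knit legs are unitary
(`parKnitY_mem_unitary_of_regQY`, numerics `c₀ ≤ 10`, `0 ≤ Mα₀`, `0 < α₀′`, `C₀α₀′ ≤ 1/3`, `2α₀′ ≤ c₂′`, `K_pl(Mα₀)·L⁴ < α₀′`), so the `R`-model over `parKnitY`
fed `G′_phys` is its own transpose (with `G := U(N)` for the legs). [cite: Balaban1985BackgroundPropagators, (3.25) p.394, (3.35) p.396, Thm 3.11 p.416]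
[cite: Balaban1985Averaging, Prop. 2 p.26] -/
theorem isTransposePair_RcoK_parKnitY_of_regQY [Nonempty (Fin N)] {θ : Stage3Params} (i : KIdx θ.d₆ θ.ℓ₆ θ.hd' θ.hL' θ.b₀ θ.b₁) (B : B9.Backgrounds)
    (cfg : B.Cfg → CfgY (Matrix (Fin N) (Fin N) ℂ) i) (U₁ : B.Cfg) {G : Subgroup (Matrix (Fin N) (Fin N) ℂ)ˣ}
    (hGU : G ≤ B7Prop2Explicit.unitaryUnits (Matrix (Fin N) (Fin N) ℂ)) {c₀ α₀ : ℝ} (hc : c₀ ≤ 10) (hMα : 0 ≤ (kGeo i).M * α₀) {α₀' : ℝ} (hα' : 0 < α₀')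
    (hα3 : C0 (θ.d₆ + 1) * α₀' ≤ 1 / 3) (hα2 : 2 * α₀' ≤ c2' (θ.d₆ + 1) (θ.ℓ₆ + 1)) (hK : Kpl i ((kGeo i).M * α₀) * (kGeo i).L ^ 4 < α₀')
    (hU : regQY G i c₀ α₀ (cfg U₁)) :
    IsTransposePair (RcoK i (trBasis N) B cfg (parKnitY i) (GpPhysY i (parKnitY i)) U₁) (RcoK i (trBasis N) B cfg (parKnitY i) (GpPhysY i (parKnitY i)) U₁) :=
  isTransposePair_RcoK_parKnitY i B cfg U₁ le_rfl (fun μ x => hGU (mem_of_regQY (i := i) hU μ x))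
    (parKnitY_mem_unitary_of_regQY i (unitBddY_of_le_unitaryUnits hGU) hGU hc hMα hα' hα3 hα2 hK hU)

/-- ★★ the same at `G := SU(N)` in member-law shape over print's member class `bg9YP … SU(N)`, threshold numerics folded (`OpsYRecordV11Thresh` convention):
under `c₀ ≤ 10`, `0 < α₀′`, `C₀α₀′ ≤ 1/3`, `2α₀′ ≤ c₂′`, `K_pl(a)·L⁴ < α₀′`, for every `α₀ > 0` with `Mα₀ ≤ a` and every `U ∈ (3.35)` read through `cfg`.
[cite: Balaban1985BackgroundPropagators, (3.25) p.394, (3.35) p.396, Thm 3.11 p.416, pp.389–390 (G ⊂ U(N))] [cite: Balaban1985Averaging, Prop. 2 p.26] -/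
theorem isTransposePair_RcoK_parKnitY_SU_threshK [Nonempty (Fin N)] {θ : Stage3Params} {Mstar : ℕ} (x : MemberY θ.d₆ θ.ℓ₆ θ.hd' θ.hL' θ.b₀ θ.b₁ Mstar)
    (B : B9.Backgrounds) (cfg : B.Cfg → CfgY (Matrix (Fin N) (Fin N) ℂ) x.toKIdx) {c₀ : ℝ} (hc : c₀ ≤ 10) {a α₀' : ℝ} (hα' : 0 < α₀')
    (hα3 : C0 (θ.d₆ + 1) * α₀' ≤ 1 / 3) (hα2 : 2 * α₀' ≤ c2' (θ.d₆ + 1) (θ.ℓ₆ + 1)) (hKa : Kpl x.toKIdx a * (kGeo x.toKIdx).L ^ 4 < α₀') :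
    ∀ α₀ : ℝ, 0 < α₀ → (geo9Y x).M * α₀ ≤ a → ∀ U₁ : B.Cfg,
      (bg9YP (Matrix (Fin N) (Fin N) ℂ) (specialUnitaryUnits (Fin N)) x).Reg335 c₀ α₀ (cfg U₁) →
        IsTransposePair (RcoK x.toKIdx (trBasis N) B cfg (parKnitY x.toKIdx) (GpPhysY x.toKIdx (parKnitY x.toKIdx)) U₁)
          (RcoK x.toKIdx (trBasis N) B cfg (parKnitY x.toKIdx) (GpPhysY x.toKIdx (parKnitY x.toKIdx)) U₁) :=
  fun _ hα₀ hMa U₁ hreg =>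
    isTransposePair_RcoK_parKnitY_of_regQY x.toKIdx B cfg U₁ specialUnitaryUnits_le_unitaryUnits hc (kGeo_M_mul_nonneg x.toKIdx hα₀.le) hα' hα3 hα2
      (Kpl_mul_L4_lt_of_thresh x.toKIdx hKa hα₀.le hMa) (regQY_of_reg335YP x hreg)

end TransposesQ

end Literature.MathematicalPhysics.QuantumFieldTheory.Balaban1983to89.Node00.OpsYSectDCoordsQ

end
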